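import Summits.QuantumAdvantage.QuantumAdvantage.Theorems.AnchorDialLaw

/-!
# AnchorDial — part 14/16 «Table» (cell decomp-qadv, seat lens-2, generation 14 rev 8; supports item 26531 `ExactnessDial.PolyLossOddU3`)
§11b of the node (rev 8): THE ENGINE IN TABLE FORM (`CWT`, `orbit_avoidsT`, `count_shellT`, `classIndT`, **`value_certificate_loss`**:
every degree-`(log₂ n)^c` table certificate with a.e.-unique flip-stable anchors fails on `≥ 2^{n-1}/47` odd inputs; part 11 is the
two-valued instance).  Verbatim from the node file `HOME/decomp-qadv-lens-2/g14/AnchorDial.lean` (rev 8); namespace `…Theorems.AnchorDial`;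
imports part 11; joint check `tree/Chain16.check.lean`; record NODE-g14.md §REV 8.  `CWT` (Prop-valued def) is a statement, not an item.
-/

set_option linter.dupNamespace false
set_option linter.unusedVariables false

noncomputable section

open scoped Classical

namespace Summit.QuantumAdvantage.QuantumAdvantage.Theorems.AnchorDial

open Finset
open Literature.Computability.QuantumComplexity Literature.Computability.QuantumComplexity.RingHLF
open Literature.Computability.MetaComplexity Literature.Computability.MetaComplexity.Smolensky
open Summit.QuantumAdvantage.AdviceFreeQNC0
open Summit.QuantumAdvantage.QuantumAdvantage.Theorems.HolonomyDial (gCond selP selP_mem selP_apply)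

variable {N : ℕ}

/-! ## §11b  THE ENGINE IN TABLE FORM (rev 8): an ARBITRARY avoid-value table over a stable unique anchor
`Core.core_four` holds for EVERY table `a : {0,1}^4 → 𝔽₃`, so the pointer engine runs unchanged for a certificate that,
over its declared anchor `k`, claims an arbitrary AVOID VALUE `g_k(x) ∈ 𝔽₃` for the hidden kernel phase `c_k(x)` (read with
entrance parity `zpar x (k+1) = 0`; with parity `1` the claim is the reflection `1 - g_k(x)`).  TABLE CERTIFICATE `CWT A g x`;
THE LAW `value_certificate_loss`: polylog `A` (a.e. unique, flip-stable) and polylog `g` ⟹ the certificate FAILS on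
`≥ 2^{n-1}/47` odd inputs.  (Node file §11b docstring abridged; the window application is part 15.) -/
section TableEngine

variable {Δ : Type*}

/-- TABLE CERTIFICATE: unique declared anchor `k`, and the kernel phase `c_k(x)` avoids the claimed value `g k x`
(reflected `a ↦ 1 - a` under odd entrance parity `zpar x (k+1)`). -/
def CWT (A g : Fin N → CubeFn (ZMod 3) N) (x : Fin N → Bool) : Prop :=
  ∃ k : Fin N, anc A x = {k} ∧
    ((cN x k.val : ℕ) : ZMod 3) ≠ (if zpar x (k.val + 1) = true then 1 - g k x else g k x)
/-- AnchorDialTable helper `zpar_orb` (decomp-qadv land package; see the module docstring). -/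
theorem zpar_orb (x : Fin N → Bool) {b₁ b₂ b₃ b₄ : ℕ} (h1 : b₁ + 2 ≤ N) (h2 : b₂ + 2 ≤ N) (h3 : b₃ + 2 ≤ N)
    (h4 : b₄ + 2 ≤ N) (ε : Core.B4) (k : ℕ) (hk : k ≤ N)
    (hne : k ≠ b₁ + 1 ∧ k ≠ b₂ + 1 ∧ k ≠ b₃ + 1 ∧ k ≠ b₄ + 1) :
    zpar (orb b₁ b₂ b₃ b₄ ε x) k = zpar x k := by
  obtain ⟨e₁, e₂, e₃, e₄⟩ := ε
  dsimp only [orb]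
  rw [zpar_fz e₁ h1 _ k hk hne.1, zpar_fz e₂ h2 _ k hk hne.2.1, zpar_fz e₃ h3 _ k hk hne.2.2.1,
    zpar_fz e₄ h4 x k hk hne.2.2.2]

/-- kernel phases along the orbit, cast to `𝔽₃`: `c_k(x^ε) = lv (sgnVec x k) (c_k x) ε`. -/
theorem cN_orb_cast (x : Fin N → Bool) {b₁ b₂ b₃ b₄ : ℕ} (h12 : b₁ + 2 ≤ b₂) (h23 : b₂ + 2 ≤ b₃)
    (h34 : b₃ + 2 ≤ b₄) (h4N : b₄ + 3 ≤ N) (ε : Core.B4) (k : ℕ) (hk : k ≤ N) :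
    ((cN (orb b₁ b₂ b₃ b₄ ε x) k : ℕ) : ZMod 3) =
      Core.lv (sgnVec b₁ b₂ b₃ b₄ x k) ((cN x k : ℕ) : ZMod 3) ε := by
  have h := cN_orb x h12 h23 h34 h4N ε k hk
  have h' := congrArg (fun v : ℕ => ((v : ℕ) : ZMod 3)) h
  simp only [ZMod.natCast_mod] at h'
  have hlv : Core.lv (sgnVec b₁ b₂ b₃ b₄ x k) ((cN x k : ℕ) : ZMod 3) ε =
      ((cN x k : ℕ) : ZMod 3) + Core.ct ε.1 (xor (zpar x (b₁ + 1)) (decide (b₁ + 1 ≤ k)))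
        + Core.ct ε.2.1 (xor (zpar x (b₂ + 1)) (decide (b₂ + 1 ≤ k)))
        + Core.ct ε.2.2.1 (xor (zpar x (b₃ + 1)) (decide (b₃ + 1 ≤ k)))
        + Core.ct ε.2.2.2 (xor (zpar x (b₄ + 1)) (decide (b₄ + 1 ≤ k))) := rfl
  rw [h', hlv]
  push_cast [sh_cast]
  rfl

/-- **THE ORBIT LAW IN TABLE FORM**: sixteen valid table certificates with common anchor `k` (off the flip sites) make
the table — reflected or not by the entrance parity — AVOID the orbit line of the hidden phase. -/
theorem orbit_avoidsT (x : Fin N → Bool) {b₁ b₂ b₃ b₄ : ℕ} (h12 : b₁ + 2 ≤ b₂) (h23 : b₂ + 2 ≤ b₃)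
    (h34 : b₃ + 2 ≤ b₄) (h4N : b₄ + 3 ≤ N) (k : ℕ) (hk : k < N) (T : Core.B4 → ZMod 3)
    (hwin : ∀ ε, ((cN (orb b₁ b₂ b₃ b₄ ε x) k : ℕ) : ZMod 3) ≠
      (if zpar x (k + 1) = true then 1 - T ε else T ε)) :
    Core.Avoids (if zpar x (k + 1) = true then Core.refl 1 T else T)
      (sgnVec b₁ b₂ b₃ b₄ x k) ((cN x k : ℕ) : ZMod 3) := by
  intro ε
  have hw := hwin ε
  rw [cN_orb_cast x h12 h23 h34 h4N ε k hk.le] at hw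
  by_cases hu : zpar x (k + 1) = true
  · rw [if_pos hu] at hw ⊢
    intro h
    exact hw h.symm
  · rw [if_neg hu] at hw ⊢
    intro h
    exact hw h.symm
/-- AnchorDialTable helper `orbit_lawT` (decomp-qadv land package; see the module docstring). -/
theorem orbit_lawT (x : Fin N → Bool) {b₁ b₂ b₃ b₄ : ℕ} (h12 : b₁ + 2 ≤ b₂) (h23 : b₂ + 2 ≤ b₃)
    (h34 : b₃ + 2 ≤ b₄) (h4N : b₄ + 3 ≤ N) (k : ℕ) (hk : k < N) (T : Core.B4 → ZMod 3)
    (hwin : ∀ ε, ((cN (orb b₁ b₂ b₃ b₄ ε x) k : ℕ) : ZMod 3) ≠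
      (if zpar x (k + 1) = true then 1 - T ε else T ε)) :
    sgnVec b₁ b₂ b₃ b₄ x k ∈ univ.filter fun σ => Core.Compat₂ 1 T σ := by
  rw [mem_filter]
  refine ⟨mem_univ _, ?_⟩
  have h := orbit_avoidsT x h12 h23 h34 h4N k hk T hwin
  by_cases hu : zpar x (k + 1) = true
  · rw [if_pos hu] at h; exact Or.inr ⟨_, h⟩
  · rw [if_neg hu] at h; exact Or.inl ⟨_, h⟩

/-- the table orbit law in certificate currency: common unique anchor along the orbit and `CWT` at all 16 points. -/
theorem orbit_law_certT (A g : Fin N → CubeFn (ZMod 3) N) (x : Fin N → Bool) {b₁ b₂ b₃ b₄ : ℕ}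
    (h12 : b₁ + 2 ≤ b₂) (h23 : b₂ + 2 ≤ b₃) (h34 : b₃ + 2 ≤ b₄) (h4N : b₄ + 3 ≤ N) (k : Fin N)
    (hkb : k.val ≠ b₁ ∧ k.val ≠ b₂ ∧ k.val ≠ b₃ ∧ k.val ≠ b₄)
    (hanc : ∀ ε, anc A (orb b₁ b₂ b₃ b₄ ε x) = {k}) (hcert : ∀ ε, CWT A g (orb b₁ b₂ b₃ b₄ ε x)) :
    sgnVec b₁ b₂ b₃ b₄ x k.val ∈
      univ.filter fun σ => Core.Compat₂ 1 (fun ε => g k (orb b₁ b₂ b₃ b₄ ε x)) σ := by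
  refine orbit_lawT x h12 h23 h34 h4N k.val k.isLt _ fun ε => ?_
  obtain ⟨k', hk', hne⟩ := hcert ε
  rw [hanc ε, Finset.singleton_inj] at hk'
  subst hk'
  rw [zpar_orb x (by omega) (by omega) (by omega) (by omega) ε (k.val + 1) (by omega)
    ⟨by omega, by omega, by omega, by omega⟩] at hne
  exact hne

/-- compatible RAW-sign classes of a table datum (no wrap case: the table form is uniform in the anchor). -/
def ZsetT (tOf : Δ → (Core.B4 → ZMod 3)) (gOf : Δ → Core.B4) (δ : Δ) : Finset Core.B4 :=
  (univ.filter fun σ => Core.Compat₂ 1 (tOf δ) σ).image fun σ => xor4 σ (gOf δ)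
/-- AnchorDialTable helper `card_ZsetT_le` (decomp-qadv land package; see the module docstring). -/
theorem card_ZsetT_le (tOf : Δ → (Core.B4 → ZMod 3)) (gOf : Δ → Core.B4) (δ : Δ) :
    (ZsetT tOf gOf δ).card ≤ 10 :=
  card_image_le.trans (Core.core_four _ _)

/-- orbit law ⇒ class membership, table form. -/
theorem full_memT (A g : Fin N → CubeFn (ZMod 3) N) {b₁ b₂ b₃ b₄ : ℕ} (h12 : b₁ + 2 ≤ b₂) (h23 : b₂ + 2 ≤ b₃)
    (h34 : b₃ + 2 ≤ b₄) (h4N : b₄ + 3 ≤ N) (dat : (Fin N → Bool) → Δ) (tOf : Δ → (Core.B4 → ZMod 3))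
    (gOf : Δ → Core.B4)
    (hdat : ∀ x (k : Fin N), anc A x = {k} →
      tOf (dat x) = (fun ε => g k (orb b₁ b₂ b₃ b₄ ε x)) ∧ gOf (dat x) = gvec b₁ b₂ b₃ b₄ k.val)
    (x : Fin N → Bool) (k : Fin N) (hk : anc A x = {k})
    (hks : k.val ≠ b₁ ∧ k.val ≠ b₂ ∧ k.val ≠ b₃ ∧ k.val ≠ b₄)
    (hOS : ∀ ε, anc A (orb b₁ b₂ b₃ b₄ ε x) = anc A x) (hW : ∀ ε, CWT A g (orb b₁ b₂ b₃ b₄ ε x)) :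
    zvec b₁ b₂ b₃ b₄ x ∈ ZsetT tOf gOf (dat x) := by
  obtain ⟨ht, hg⟩ := hdat x k hk
  unfold ZsetT
  rw [ht, hg, show zvec b₁ b₂ b₃ b₄ x = xor4 (sgnVec b₁ b₂ b₃ b₄ x k.val) (gvec b₁ b₂ b₃ b₄ k.val) by
      rw [sgnVec_eq, xor4_xor4]]
  exact mem_image_of_mem _ (orbit_law_certT A g x h12 h23 h34 h4N k hks (fun ε => (hOS ε).trans hk) hW)

/-- **THE COUNTING SHELL, table form** (verbatim `count_shell` with `CWT` and the table datum). -/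
theorem count_shellT [Fintype Δ] [DecidableEq Δ] (A g : Fin N → CubeFn (ZMod 3) N) {b₁ b₂ b₃ b₄ : ℕ}
    (h12 : b₁ + 2 ≤ b₂) (h23 : b₂ + 2 ≤ b₃) (h34 : b₃ + 2 ≤ b₄) (h4N : b₄ + 3 ≤ N)
    (dat : (Fin N → Bool) → Δ) (tOf : Δ → (Core.B4 → ZMod 3)) (gOf : Δ → Core.B4)
    (hdat : ∀ x (k : Fin N), anc A x = {k} →
      tOf (dat x) = (fun ε => g k (orb b₁ b₂ b₃ b₄ ε x)) ∧ gOf (dat x) = gvec b₁ b₂ b₃ b₄ k.val)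
    (η : ℕ)
    (hequi : ∀ δ z₀, 32 * (univ.filter fun x => OddZeros x ∧ dat x = δ ∧ zvec b₁ b₂ b₃ b₄ x = z₀).card ≤
      (univ.filter fun x => dat x = δ).card + 32 * η) :
    32 * (univ.filter fun x : Fin N → Bool => OddZeros x).card ≤
      32 * (univ.filter fun x : Fin N → Bool => OddZeros x ∧ (anc A x).card ≠ 1).card
      + 512 * ((univ.filter fun x => UB A b₁ x).card + (univ.filter fun x => UB A b₂ x).card
          + (univ.filter fun x => UB A b₃ x).card + (univ.filter fun x => UB A b₄ x).card)
      + 32 * (univ.filter fun x : Fin N → Bool => OddZeros x ∧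
          ∃ k, anc A x = {k} ∧ (k.val = b₁ ∨ k.val = b₂ ∨ k.val = b₃ ∨ k.val = b₄)).card
      + (10 * Fintype.card (Fin N → Bool) + 320 * Fintype.card Δ * η)
      + 512 * (univ.filter fun x : Fin N → Bool => OddZeros x ∧ ¬ CWT A g x).card := by
  set NU := univ.filter fun x : Fin N → Bool => OddZeros x ∧ (anc A x).card ≠ 1 with hNU
  set UN := univ.filter fun x : Fin N → Bool => ∃ ε' : Core.B4, UB A b₁ (orb b₁ b₂ b₃ b₄ ε' x) ∨
    UB A b₂ (orb b₁ b₂ b₃ b₄ ε' x) ∨ UB A b₃ (orb b₁ b₂ b₃ b₄ ε' x) ∨ UB A b₄ (orb b₁ b₂ b₃ b₄ ε' x) with hUN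
  set SI := univ.filter fun x : Fin N → Bool => OddZeros x ∧
    ∃ k, anc A x = {k} ∧ (k.val = b₁ ∨ k.val = b₂ ∨ k.val = b₃ ∨ k.val = b₄) with hSI
  set BIG := univ.filter fun x : Fin N → Bool => OddZeros x ∧ zvec b₁ b₂ b₃ b₄ x ∈ ZsetT tOf gOf (dat x)
    with hBIG
  set HL := univ.filter fun x : Fin N → Bool => ∃ ε : Core.B4,
    OddZeros (orb b₁ b₂ b₃ b₄ ε x) ∧ ¬ CWT A g (orb b₁ b₂ b₃ b₄ ε x) with hHL
  have hcov : (univ.filter fun x : Fin N → Bool => OddZeros x) ⊆ NU ∪ UN ∪ SI ∪ BIG ∪ HL := by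
    intro x hx
    rw [mem_filter] at hx
    have hodd := hx.2
    simp only [mem_union]
    by_cases hc : (anc A x).card = 1
    · obtain ⟨k, hk⟩ := card_eq_one.1 hc
      by_cases hos : ∀ ε, anc A (orb b₁ b₂ b₃ b₄ ε x) = anc A x
      · by_cases hsite : k.val = b₁ ∨ k.val = b₂ ∨ k.val = b₃ ∨ k.val = b₄
        · exact Or.inl (Or.inl (Or.inr (mem_filter.2 ⟨mem_univ _, hodd, k, hk, hsite⟩)))
        · have hks : k.val ≠ b₁ ∧ k.val ≠ b₂ ∧ k.val ≠ b₃ ∧ k.val ≠ b₄ := by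
            push Not at hsite
            exact hsite
          by_cases hall : ∀ ε, CWT A g (orb b₁ b₂ b₃ b₄ ε x)
          · exact Or.inl (Or.inr (mem_filter.2 ⟨mem_univ _, hodd,
              full_memT A g h12 h23 h34 h4N dat tOf gOf hdat x k hk hks hos hall⟩))
          · push Not at hall
            obtain ⟨ε, hε⟩ := hall
            exact Or.inr (mem_filter.2 ⟨mem_univ _, ε,
              (oddZeros_orb (by omega) (by omega) (by omega) (by omega) ε x).2 hodd, hε⟩)
      · push Not at hos
        obtain ⟨ε, hε⟩ := hos
        exact Or.inl (Or.inl (Or.inl (Or.inr (mem_filter.2 ⟨mem_univ _,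
          unst_cover A h12 h23 h34 h4N x hodd ε hε⟩))))
    · exact Or.inl (Or.inl (Or.inl (Or.inl (mem_filter.2 ⟨mem_univ _, hodd, hc⟩))))
  have hc1 := (card_le_card hcov).trans ((card_union_le _ _).trans (Nat.add_le_add_right
    ((card_union_le _ _).trans (Nat.add_le_add_right ((card_union_le _ _).trans (Nat.add_le_add_right
    (card_union_le _ _) _)) _)) _))
  have hUN4 : UN ⊆ (univ.filter fun x => ∃ ε' : Core.B4, UB A b₁ (orb b₁ b₂ b₃ b₄ ε' x)) ∪
      (univ.filter fun x => ∃ ε' : Core.B4, UB A b₂ (orb b₁ b₂ b₃ b₄ ε' x)) ∪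
      (univ.filter fun x => ∃ ε' : Core.B4, UB A b₃ (orb b₁ b₂ b₃ b₄ ε' x)) ∪
      (univ.filter fun x => ∃ ε' : Core.B4, UB A b₄ (orb b₁ b₂ b₃ b₄ ε' x)) := by
    intro x hx
    rw [hUN, mem_filter] at hx
    obtain ⟨ε', h⟩ := hx.2
    simp only [mem_union, mem_filter, mem_univ, true_and]
    rcases h with h | h | h | h
    · exact Or.inl (Or.inl (Or.inl ⟨ε', h⟩))
    · exact Or.inl (Or.inl (Or.inr ⟨ε', h⟩))
    · exact Or.inl (Or.inr ⟨ε', h⟩)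
    · exact Or.inr ⟨ε', h⟩
  have hu := (card_le_card hUN4).trans ((card_union_le _ _).trans (Nat.add_le_add_right
    ((card_union_le _ _).trans (Nat.add_le_add_right (card_union_le _ _) _)) _))
  have hu1 := card_exists_orb_le b₁ b₂ b₃ b₄ (UB A b₁)
  have hu2 := card_exists_orb_le b₁ b₂ b₃ b₄ (UB A b₂)
  have hu3 := card_exists_orb_le b₁ b₂ b₃ b₄ (UB A b₃)
  have hu4 := card_exists_orb_le b₁ b₂ b₃ b₄ (UB A b₄)
  have hl : HL.card ≤ 16 * (univ.filter fun x : Fin N → Bool => OddZeros x ∧ ¬ CWT A g x).card :=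
    card_exists_orb_le b₁ b₂ b₃ b₄ (fun y : Fin N → Bool => OddZeros y ∧ ¬ CWT A g y)
  have hbig : 32 * BIG.card ≤ 10 * Fintype.card (Fin N → Bool) + 320 * Fintype.card Δ * η :=
    card_big_le dat (ZsetT tOf gOf) (card_ZsetT_le tOf gOf) (zvec b₁ b₂ b₃ b₄) OddZeros η hequi
  omega

/-- value datum: the claimed value at the anchor, read on an orbit point (`Σ_k selP(A_k)·(g_k ∘ orb_ε)`). -/
def dVal (A g : Fin N → CubeFn (ZMod 3) N) (b₁ b₂ b₃ b₄ : ℕ) (ε : Core.B4) : CubeFn (ZMod 3) N :=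
  ∑ k : Fin N, selP (A k) * fun x => g k (orb b₁ b₂ b₃ b₄ ε x)
/-- AnchorDialTable helper `dVal_mem` (decomp-qadv land package; see the module docstring). -/
theorem dVal_mem {D : ℕ} {A g : Fin N → CubeFn (ZMod 3) N} (hA : ∀ k, A k ∈ lowDeg (ZMod 3) N D)
    (hg : ∀ k, g k ∈ lowDeg (ZMod 3) N D) (b₁ b₂ b₃ b₄ : ℕ) (ε : Core.B4) :
    dVal A g b₁ b₂ b₃ b₄ ε ∈ lowDeg (ZMod 3) N ((D + D) + D) := by
  unfold dVal
  exact Submodule.sum_mem _ fun k _ =>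
    mul_mem_lowDeg_add (selP_mem (hA k)) (comp_orb_mem (hg k) b₁ b₂ b₃ b₄ ε)

/-- the table datum (same type `DatT` as §9; the wrap slot is kept but unused). -/
def datumT (A g : Fin N → CubeFn (ZMod 3) N) (b₁ b₂ b₃ b₄ : ℕ) (x : Fin N → Bool) : DatT :=
  (fun ε => dVal A g b₁ b₂ b₃ b₄ ε x, (dGap A b₁ x, dGap A b₂ x, dGap A b₃ x, dGap A b₄ x), dWrap A x)
/-- AnchorDialTable helper `tOfD` (decomp-qadv land package; see the module docstring). -/
def tOfD (δ : DatT) : Core.B4 → ZMod 3 := δ.1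
/-- AnchorDialTable helper `datumT_faithful` (decomp-qadv land package; see the module docstring). -/
theorem datumT_faithful (A g : Fin N → CubeFn (ZMod 3) N) (b₁ b₂ b₃ b₄ : ℕ) (x : Fin N → Bool) (k₀ : Fin N)
    (hk : anc A x = {k₀}) :
    tOfD (datumT A g b₁ b₂ b₃ b₄ x) = (fun ε => g k₀ (orb b₁ b₂ b₃ b₄ ε x)) ∧
      gOfD (datumT A g b₁ b₂ b₃ b₄ x) = gvec b₁ b₂ b₃ b₄ k₀.val := by
  have hval : ∀ ε, dVal A g b₁ b₂ b₃ b₄ ε x = g k₀ (orb b₁ b₂ b₃ b₄ ε x) := by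
    intro ε
    unfold dVal
    rw [Finset.sum_apply, Finset.sum_eq_single k₀]
    · rw [Pi.mul_apply, selP_anchor hk, if_pos rfl, one_mul]
    · intro k _ hk0
      rw [Pi.mul_apply, selP_anchor hk, if_neg hk0, zero_mul]
    · intro h; exact absurd (mem_univ _) h
  have hgap : ∀ b : ℕ, dGap A b x = if b + 1 ≤ k₀.val then 1 else 0 := by
    intro b
    unfold dGap
    rw [Finset.sum_apply]
    simp_rw [selP_anchor hk]
    rw [Finset.sum_ite_eq' (univ.filter fun k : Fin N => b + 1 ≤ k.val) k₀ (fun _ => (1 : ZMod 3))]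
    simp only [mem_filter, mem_univ, true_and]
  refine ⟨?_, ?_⟩
  · funext ε
    exact hval ε
  · show (decide (dGap A b₁ x = 1), decide (dGap A b₂ x = 1), decide (dGap A b₃ x = 1), decide (dGap A b₄ x = 1))
      = gvec b₁ b₂ b₃ b₄ k₀.val
    rw [hgap, hgap, hgap, hgap, decide_ite01, decide_ite01, decide_ite01, decide_ite01]
    rfl

/-- class indicator of the table datum. -/
def classIndT (A g : Fin N → CubeFn (ZMod 3) N) (b₁ b₂ b₃ b₄ : ℕ) (δ : DatT) : CubeFn (ZMod 3) N :=
  (∏ ε : Core.B4, indEq (dVal A g b₁ b₂ b₃ b₄ ε) (δ.1 ε)) *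
    (indEq (dGap A b₁) δ.2.1.1 * indEq (dGap A b₂) δ.2.1.2.1 * indEq (dGap A b₃) δ.2.1.2.2.1 *
      indEq (dGap A b₄) δ.2.1.2.2.2 * indEq (dWrap A) δ.2.2)
/-- AnchorDialTable helper `classIndT_mem` (decomp-qadv land package; see the module docstring). -/
theorem classIndT_mem {D : ℕ} {A g : Fin N → CubeFn (ZMod 3) N} (hA : ∀ k, A k ∈ lowDeg (ZMod 3) N D)
    (hg : ∀ k, g k ∈ lowDeg (ZMod 3) N D) (b₁ b₂ b₃ b₄ : ℕ) (δ : DatT) :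
    classIndT A g b₁ b₂ b₃ b₄ δ ∈ lowDeg (ZMod 3) N (148 * D) := by
  unfold classIndT
  have hs : ∀ ε, indEq (dVal A g b₁ b₂ b₃ b₄ ε) (δ.1 ε) ∈ lowDeg (ZMod 3) N (8 * D) := fun ε => by
    have h := indEq_mem (dVal_mem hA hg b₁ b₂ b₃ b₄ ε) (δ.1 ε)
    exact lowDeg_mono (by omega) h
  have hprod : (∏ ε : Core.B4, indEq (dVal A g b₁ b₂ b₃ b₄ ε) (δ.1 ε)) ∈ lowDeg (ZMod 3) N (128 * D) := by
    have h := prod_mem_lowDeg (univ : Finset Core.B4) (D := 8 * D) (fun ε _ => hs ε)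
    rw [card_univ, card_B4] at h
    exact lowDeg_mono (by omega) h
  have hgp : ∀ b c, indEq (dGap A b) c ∈ lowDeg (ZMod 3) N (4 * D) := fun b c =>
    lowDeg_mono (by omega) (indEq_mem (dGap_mem hA b) c)
  have hw : ∀ c, indEq (dWrap A) c ∈ lowDeg (ZMod 3) N (4 * D) := fun c =>
    lowDeg_mono (by omega) (indEq_mem (dWrap_mem hA) c)
  have hrest : indEq (dGap A b₁) δ.2.1.1 * indEq (dGap A b₂) δ.2.1.2.1 * indEq (dGap A b₃) δ.2.1.2.2.1 *
      indEq (dGap A b₄) δ.2.1.2.2.2 * indEq (dWrap A) δ.2.2 ∈ lowDeg (ZMod 3) N (20 * D) := by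
    have h := mul_mem_lowDeg_add (mul_mem_lowDeg_add (mul_mem_lowDeg_add (mul_mem_lowDeg_add
      (hgp b₁ δ.2.1.1) (hgp b₂ δ.2.1.2.1)) (hgp b₃ δ.2.1.2.2.1)) (hgp b₄ δ.2.1.2.2.2)) (hw δ.2.2)
    exact lowDeg_mono (by omega) h
  exact lowDeg_mono (by omega) (mul_mem_lowDeg_add hprod hrest)
/-- AnchorDialTable helper `classIndT_apply` (decomp-qadv land package; see the module docstring). -/
theorem classIndT_apply (A g : Fin N → CubeFn (ZMod 3) N) (b₁ b₂ b₃ b₄ : ℕ) (δ : DatT) (x : Fin N → Bool) :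
    classIndT A g b₁ b₂ b₃ b₄ δ x = if datumT A g b₁ b₂ b₃ b₄ x = δ then 1 else 0 := by
  obtain ⟨δs, ⟨q₁, q₂, q₃, q₄⟩, w⟩ := δ
  simp only [classIndT, Pi.mul_apply, Finset.prod_apply, indEq_apply]
  rw [Finset.prod_boole]
  simp only [mem_univ, true_implies]
  by_cases h : datumT A g b₁ b₂ b₃ b₄ x = (δs, (q₁, q₂, q₃, q₄), w)
  · rw [if_pos h]
    simp only [datumT, Prod.mk.injEq] at h
    obtain ⟨hs, ⟨h1, h2, h3, h4⟩, hw⟩ := h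
    rw [if_pos (fun ε => congrFun hs ε), if_pos h1, if_pos h2, if_pos h3, if_pos h4, if_pos hw]
    norm_num
  · rw [if_neg h]
    simp only [datumT, Prod.mk.injEq, not_and_or] at h
    rcases h with h | h | h
    · rw [if_neg (fun hall => h (funext hall))]; simp
    · rcases h with h | h | h | h
      · rw [if_neg h]; simp
      · rw [if_neg h]; simp
      · rw [if_neg h]; simp
      · rw [if_neg h]; simp
    · rw [if_neg h]; simp

/-- AnchorDialTable helper `classIndT_eq_one_iff` (decomp-qadv land package; see the module docstring). -/
theorem classIndT_eq_one_iff (A g : Fin N → CubeFn (ZMod 3) N) (b₁ b₂ b₃ b₄ : ℕ) (δ : DatT)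
    (x : Fin N → Bool) : classIndT A g b₁ b₂ b₃ b₄ δ x = 1 ↔ datumT A g b₁ b₂ b₃ b₄ x = δ := by
  rw [classIndT_apply]
  by_cases h : datumT A g b₁ b₂ b₃ b₄ x = δ
  · simp [h]
  · rw [if_neg h]; simp [h]

/-- the table shell at admissible sites with EQUI. -/
theorem shell_atT (A g : Fin N → CubeFn (ZMod 3) N) {D : ℕ} (hA : ∀ k, A k ∈ lowDeg (ZMod 3) N D)
    (hg : ∀ k, g k ∈ lowDeg (ZMod 3) N D) {b₁ b₂ b₃ b₄ : ℕ}
    (h12 : b₁ + 2 ≤ b₂) (h23 : b₂ + 2 ≤ b₃) (h34 : b₃ + 2 ≤ b₄) (h4N : b₄ + 3 ≤ N) (η : ℕ)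
    (hE : Equi5 N (148 * D) b₁ b₂ b₃ b₄ η) :
    32 * (univ.filter fun x : Fin N → Bool => OddZeros x).card ≤
      32 * (univ.filter fun x : Fin N → Bool => OddZeros x ∧ (anc A x).card ≠ 1).card
      + 512 * ((univ.filter fun x => UB A b₁ x).card + (univ.filter fun x => UB A b₂ x).card
          + (univ.filter fun x => UB A b₃ x).card + (univ.filter fun x => UB A b₄ x).card)
      + 32 * (univ.filter fun x : Fin N → Bool => OddZeros x ∧
          ∃ k, anc A x = {k} ∧ (k.val = b₁ ∨ k.val = b₂ ∨ k.val = b₃ ∨ k.val = b₄)).card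
      + (10 * Fintype.card (Fin N → Bool) + 320 * Fintype.card DatT * η)
      + 512 * (univ.filter fun x : Fin N → Bool => OddZeros x ∧ ¬ CWT A g x).card :=
  count_shellT A g h12 h23 h34 h4N (datumT A g b₁ b₂ b₃ b₄) tOfD gOfD
    (fun x k hk => datumT_faithful A g b₁ b₂ b₃ b₄ x k hk) η
    (fun δ z₀ => by
      have h := hE (classIndT A g b₁ b₂ b₃ b₄ δ) (classIndT_mem hA hg b₁ b₂ b₃ b₄ δ) z₀
      refine le_trans (le_of_eq (congrArg (32 * ·) (congrArg Finset.card (Finset.ext fun x => ?_))))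
        (le_trans h (le_of_eq (congrArg (· + 32 * η) (congrArg Finset.card (Finset.ext fun x => ?_)))))
      · simp only [mem_filter, classIndT_eq_one_iff]
      · simp only [mem_filter, classIndT_eq_one_iff])

/-- **THE LAW IN TABLE FORM** (`value_certificate_loss`): for every `c` and all large `n`, every degree-`(log₂ n)^c`
TABLE certificate `(A, g)` on the `n`-cycle — anchor indicators `A_k` a.e. unique and flip-stable as in
`pointer_certificate_loss`, and ANY degree-`(log₂ n)^c` value polynomials `g_k` — has at least `2^{n-1}/47` odd
inputs on which the certificate «unique anchor `k` and `c_k(x) ≠ g_k(x)` (`≠ 1 - g_k(x)` under odd entrance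
parity)» FAILS.  The pointer law is the two-valued instance `g_k = 1 + [f_k = 1]`; every bounded- or polylog-window
deviation strategy is an instance (§12i). -/
theorem value_certificate_loss (c : ℕ) : ∃ n₀ : ℕ, ∀ n ≥ n₀, ∀ A g : Fin n → CubeFn (ZMod 3) n,
    (∀ k, A k ∈ lowDeg (ZMod 3) n ((Nat.log 2 n) ^ c)) → (∀ k, g k ∈ lowDeg (ZMod 3) n ((Nat.log 2 n) ^ c)) →
    4096 * (univ.filter fun x : Fin n → Bool =>
        OddZeros x ∧ (univ.filter fun k : Fin n => A k x = 1).card ≠ 1).card ≤ 2 ^ (n - 1) →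
    4096 * (∑ a ∈ range n, (univ.filter fun x : Fin n → Bool =>
        OddZeros x ∧ ∃ k : Fin n, ¬ ((A k (flip2 a (a + 1) x) = 1) ↔ (A k x = 1))).card) ≤ n * 2 ^ (n - 1) →
      2 ^ (n - 1) ≤ 47 * (univ.filter fun x : Fin n → Bool => OddZeros x ∧
          ¬ ∃ k : Fin n, (univ.filter fun k' : Fin n => A k' x = 1) = {k} ∧
            ((cN x k.val : ℕ) : ZMod 3) ≠ (if zpar x (k.val + 1) = true then 1 - g k x else g k x)).card := by
  obtain ⟨n₀, hn₀⟩ := equi5Hyp c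
  refine ⟨n₀, fun n hn A g hA hg hU hS => ?_⟩
  obtain ⟨m, η, hm, h5, h7, hη, hE⟩ := hn₀ n hn
  obtain ⟨t, ht, hpl⟩ := placement m n (by omega) (by omega)
    (fun a => (univ.filter fun x : Fin n → Bool => UB A a x).card) (Hc A)
  have hsh := shell_atT A g hA hg (b₁ := m + t) (b₂ := 2 * m + t) (b₃ := 3 * m + t) (b₄ := 4 * m + t)
    (by omega) (by omega) (by omega) (by omega) η (hE t ht)
  rw [card_DatT, Fintype.card_fun, Fintype.card_bool, Fintype.card_fin] at hsh
  have hU' : 4096 * (univ.filter fun x : Fin n → Bool => OddZeros x ∧ (anc A x).card ≠ 1).card ≤ 2 ^ (n - 1) := hU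
  have hS' : 4096 * ∑ a ∈ range n, (univ.filter fun x : Fin n → Bool => UB A a x).card ≤ n * 2 ^ (n - 1) := by
    have e : ∀ a : ℕ, (univ.filter fun x : Fin n → Bool => UB A a x) = (univ.filter fun x : Fin n → Bool =>
        OddZeros x ∧ ∃ k : Fin n, ¬ ((A k (flip2 a (a + 1) x) = 1) ↔ (A k x = 1))) := fun a => by
      ext x; simp only [mem_filter, UB]
    simp_rw [e]
    exact hS
  have hO := card_odd_ge (N := n) (by omega)
  have hO' := HolonomyDial.card_odd_le (n := n) (by omega)
  have hSH := sum_Hc_le A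
  have hsite := card_site_le A (m + t) (2 * m + t) (3 * m + t) (4 * m + t)
  have h2n : 2 ^ n = 2 * 2 ^ (n - 1) := by
    rw [← pow_succ']
    congr 1
    omega
  rw [h2n] at hsh
  have key := arith_core47 n m _ (2 ^ (n - 1)) _ _ _ _ _ _
    ((univ.filter fun x : Fin n → Bool => OddZeros x ∧ ¬ CWT A g x).card) η hm h7 hO hO' hU' hS' hpl hSH
    hsite hη (by omega)
  have eL : (univ.filter fun x : Fin n → Bool => OddZeros x ∧ ¬ ∃ k : Fin n,
      (univ.filter fun k' : Fin n => A k' x = 1) = {k} ∧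
        ((cN x k.val : ℕ) : ZMod 3) ≠ (if zpar x (k.val + 1) = true then 1 - g k x else g k x)) =
      (univ.filter fun x : Fin n → Bool => OddZeros x ∧ ¬ CWT A g x) := by
    ext x; simp only [mem_filter, CWT, anc]
  rw [eL]
  exact key

end TableEngine

end Summit.QuantumAdvantage.QuantumAdvantage.Theorems.AnchorDial

end
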